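import Summits.QuantumFields.YangMills.Theorems.UnitScaleTiltProp7PinnedFlatCoercivity
import HarnessLib

/-!
# Route `UnitScaleTilt`, crux K1 «MinimiserStabilityRegPr» (stmt-QuantumFields-19200), route-R E′ path (α′) — the displayed row `hInterp` of ✓∕⧗ `…CentreHarmonicRegaugeSup` REDUCED TO
# ONE KERNEL BOUND: the pinned-biharmonic interpolation error is `φ − φ_H = Σ_z (Δ_zG₂)(·,z)·(Δφ)(z)`, hence `∂(φ − φ_H)(b) = Σ_z K(b,z)·(Δφ)(z)` and
# `‖∂(φ − φ_H)(b)‖ ≤ (Σ_z|K(b,z)|)·sup‖Δφ‖` — the error sees `Δφ = ∂^*A` ONLY (no Calderón–Zygmund, no `sup‖A‖`)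

Cell `ym3-torus`, D-0154 (3c) twin-width seat `ym-routeR-w3` (gen 5); ★p1 g14 17:21:50Z «routeR-w3: hInterp SUPPLIER»; LOCATE `ym-routeR-w3/LOCATE-HINTERP-routeRw3g5.md` §1 (this file),
§2 (the kernel bound hK: near field `Σ_{r≤2ℓ}|∇G₁| ≍ ℓ` + decay of the pinned interpolation weights — NOT here).  THEOREMS ONLY (0 `def`, 0 `sorry`); `--supports stmt-QuantumFields-19200`,
count-neutral.  YM₃ on T³ is a ladder rung (R3), not the Clay problem; nothing here claims the stub, the crux, d = 4 or the gap.

WHAT IS PROVED (ns `…Theorems.Prop7CentreHarmonicInterpKernel`; any `P`, level `j`, real normed `V`, lattice factor `c`; `LatticeFieldCalculus` letters).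
* §1 `sum_smul_laplace_comm` — the lattice Laplacian is symmetric against a real kernel: `Σ_z g(z)•(Δu)(z) = Σ_z (Δg)(z)•u(z)` (shift bijections of the torus).
* §2 ★★ `interp_error_eq_kernel` — for a real matrix `G` REPRESENTING the pinned functions (`e|_C = 0 ⇒ e(x) = Σ_z G(x,z)•(Δ²e)(z)`) and VANISHING at the pins (`G(x, y∈C) = 0`), every
  `φ` and every pinned interpolant `φ_H` (`φ_H|_C = φ|_C`) that is BIHARMONIC off `C` (`Δ²φ_H = 0` off `C`): `(φ − φ_H)(x) = Σ_z (Δ_zG(x,·))(z)•(Δφ)(z)`.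
* §3 ★★ `grad_interp_error_eq_kernel` (`∂(φ − φ_H)(b) = Σ_z K(b,z)•(Δφ)(z)`, `K(b,z) = c·((Δ_zG)(b₊,z) − (Δ_zG)(b₋,z))`) and ★★★ `norm_grad_interp_error_le`
  (`‖∂(φ − φ_H)(b)‖ ≤ (Σ_z|K(b,z)|)·s₁` whenever `‖Δφ(z)‖ ≤ s₁`): so `hInterp` of ✓ `…CentreHarmonicRegaugeSup.sup_regauge_le_of_rows` with `c_I·ℓ := sup_b Σ_z|K(b,z)|` ⟸ the
  kernel bound (hK) `Σ_z|K(b,z)| ≤ c_I·ℓ` ALONE.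
HONEST SCOPE.  Linear algebra over a DISPLAYED Green's matrix (`hGrep`, `hG0` = existence∕shape of the inverse of `Δ²` on `{e : e|_C = 0}` — finite-dimensional, positive definite for
`C ≠ ∅`, not constructed here); the analytic row (hK) (near-field lattice Green's gradient + decay of the pinned biharmonic weights at scale ℓ) is the next file.  Flat letters only.

References: T. Bałaban, CMP 95 (1984) 17–40 [Balaban1984PropagatorsI] ((1.4) p.18, (1.21) p.21); CMP 89 (1983) 571–597 [Balaban1983RegularityDecay] ((2.27) p.580);
CMP 99 (1985) 75–102 [Balaban1985RegularSpaces] ((1.14) p.78, (1.36) p.82).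
-/

set_option autoImplicit false

noncomputable section

open scoped BigOperators

namespace Summit.QuantumFields.YangMills.Theorems.Prop7CentreHarmonicInterpKernel

open Literature.MathematicalPhysics.QuantumFieldTheory.Balaban1983to89
open Finset LatticeFieldCalculus

variable {P : Params} {j : ℕ} {V : Type*} [NormedAddCommGroup V] [NormedSpace ℝ V]

/-! ## §1 Symmetry of the Laplacian against a real kernel -/

/-- reindexing a site sum by `z ↦ z + e_μ`. [folklore] -/
theorem sum_comp_shift {α : Type*} [AddCommMonoid α] (μ : Fin P.d) (F : Site P j → α) :
    ∑ z : Site P j, F (z.shift μ) = ∑ z : Site P j, F z :=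
  Equiv.sum_comp (shiftEquiv (P := P) (j := j) μ) F

/-- reindexing a site sum by `z ↦ z − e_μ`. [folklore] -/
theorem sum_comp_unshift' {α : Type*} [AddCommMonoid α] (μ : Fin P.d) (F : Site P j → α) :
    ∑ z : Site P j, F (z.unshift μ) = ∑ z : Site P j, F z :=
  Equiv.sum_comp (shiftEquiv (P := P) (j := j) μ).symm F

/-- **`Σ_z g(z)•(Δu)(z) = Σ_z (Δg)(z)•u(z)`** — the lattice Laplacian is symmetric (real kernel `g`, `V`-valued `u`). [cite: Balaban1984PropagatorsI, (1.21) p.21] -/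
theorem sum_smul_laplace_comm (c : ℝ) (g : SiteField P j ℝ) (u : SiteField P j V) :
    ∑ z : Site P j, g z • laplace c u z = ∑ z : Site P j, laplace c g z • u z := by
  simp only [laplace, Finset.smul_sum, Finset.sum_smul]
  rw [Finset.sum_comm]
  conv_rhs => rw [Finset.sum_comm]
  refine Finset.sum_congr rfl fun μ _ => ?_
  -- per direction: `Σ_z g z•(2u z − u(z+e) − u(z−e)) = Σ_z (2g z − g(z+e) − g(z−e))•u z`
  have h1 : ∑ z : Site P j, g z • u (z.shift μ) = ∑ z : Site P j, g (z.unshift μ) • u z := by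
    rw [← sum_comp_unshift' μ (fun z => g z • u (z.shift μ))]
    refine Finset.sum_congr rfl fun z _ => ?_
    rw [show (z.unshift μ).shift μ = z from (shiftEquiv (P := P) (j := j) μ).apply_symm_apply z]
  have h2 : ∑ z : Site P j, g z • u (z.unshift μ) = ∑ z : Site P j, g (z.shift μ) • u z := by
    rw [← sum_comp_shift μ (fun z => g z • u (z.unshift μ))]
    refine Finset.sum_congr rfl fun z _ => ?_
    rw [show (z.shift μ).unshift μ = z from (shiftEquiv (P := P) (j := j) μ).symm_apply_apply z]
  have eL : ∀ z : Site P j, g z • ((c ^ 2) • (u z + u z - u (z.shift μ) - u (z.unshift μ)))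
      = (c ^ 2) • (g z • u z) + (c ^ 2) • (g z • u z) - (c ^ 2) • (g z • u (z.shift μ)) - (c ^ 2) • (g z • u (z.unshift μ)) := by
    intro z; module
  have eR : ∀ z : Site P j, ((c ^ 2) • (g z + g z - g (z.shift μ) - g (z.unshift μ))) • u z
      = (c ^ 2) • (g z • u z) + (c ^ 2) • (g z • u z) - (c ^ 2) • (g (z.shift μ) • u z) - (c ^ 2) • (g (z.unshift μ) • u z) := by
    intro z
    rw [smul_eq_mul]
    module
  simp only [eL, eR, Finset.sum_add_distrib, Finset.sum_sub_distrib, ← Finset.smul_sum, h1, h2]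
  abel

/-- the Laplacian of a difference (linearity). [folklore] -/
theorem laplace_sub' (c : ℝ) (u v : SiteField P j V) :
    laplace c (fun w => u w - v w) = fun z => laplace c u z - laplace c v z := by
  funext z
  simp only [laplace, ← Finset.sum_sub_distrib]
  refine Finset.sum_congr rfl fun μ _ => ?_
  module

/-! ## §2 ★★ The interpolation error through the Green's matrix -/

/-- ★★ **THE PINNED-BIHARMONIC INTERPOLATION ERROR SEES `Δφ` ONLY**: with a real matrix `G` representing every pinned function through its bi-Laplacian
(`hGrep`) and vanishing at the pins (`hG0`), for `φ_H` a pinned interpolant of `φ|_C` that is biharmonic off `C`: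
`(φ − φ_H)(x) = Σ_z (Δ_zG(x,·))(z)•(Δφ)(z)`. [cite: Balaban1984PropagatorsI, (1.21) p.21; Balaban1985RegularSpaces, (1.14) p.78] -/
theorem interp_error_eq_kernel (c : ℝ) (C : Set (Site P j)) (G : Site P j → Site P j → ℝ)
    (hGrep : ∀ e : SiteField P j V, (∀ y ∈ C, e y = 0) → ∀ x, e x = ∑ z, G x z • laplace c (laplace c e) z)
    (hG0 : ∀ x, ∀ y ∈ C, G x y = 0)
    (φ φH : SiteField P j V) (hH : ∀ y ∈ C, φH y = φ y) (hEL : ∀ z ∉ C, laplace c (laplace c φH) z = 0) (x : Site P j) :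
    φ x - φH x = ∑ z, laplace c (fun w => G x w) z • laplace c φ z := by
  classical
  set e : SiteField P j V := fun w => φ w - φH w with he
  have heC : ∀ y ∈ C, e y = 0 := fun y hy => by simp [he, hH y hy]
  have h1 : e x = ∑ z, G x z • laplace c (laplace c e) z := hGrep e heC x
  -- `Δ²e = Δ²φ − Δ²φ_H`, and the `φ_H` term dies: off `C` by `hEL`, on `C` by `hG0`
  have hlin : ∀ z, laplace c (laplace c e) z = laplace c (laplace c φ) z - laplace c (laplace c φH) z := by
    intro z
    have e1 : e = fun w => φ w - φH w := rfl
    rw [e1, laplace_sub', laplace_sub']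
  have h2 : ∑ z, G x z • laplace c (laplace c e) z = ∑ z, G x z • laplace c (laplace c φ) z := by
    refine Finset.sum_congr rfl fun z _ => ?_
    rw [hlin z]
    by_cases hz : z ∈ C
    · rw [hG0 x z hz, zero_smul, zero_smul]
    · rw [hEL z hz, sub_zero]
  rw [show φ x - φH x = e x from rfl, h1, h2, sum_smul_laplace_comm]

/-! ## §3 ★★★ The gradient of the error and the reduction of `hInterp` to a kernel bound -/

/-- ★★ **`∂(φ − φ_H)(b) = Σ_z K(b,z)•(Δφ)(z)`**, `K(b,z) = c·((Δ_zG)(b₊,z) − (Δ_zG)(b₋,z))`. [cite: Balaban1984PropagatorsI, (1.4) p.18] -/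
theorem grad_interp_error_eq_kernel (c : ℝ) (C : Set (Site P j)) (G : Site P j → Site P j → ℝ)
    (hGrep : ∀ e : SiteField P j V, (∀ y ∈ C, e y = 0) → ∀ x, e x = ∑ z, G x z • laplace c (laplace c e) z)
    (hG0 : ∀ x, ∀ y ∈ C, G x y = 0)
    (φ φH : SiteField P j V) (hH : ∀ y ∈ C, φH y = φ y) (hEL : ∀ z ∉ C, laplace c (laplace c φH) z = 0) (b : PBond P j) :
    grad c (fun x => φ x - φH x) b
      = ∑ z, (c * (laplace c (fun w => G b.tgt w) z - laplace c (fun w => G b.src w) z)) • laplace c φ z := by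
  simp only [grad]
  rw [interp_error_eq_kernel c C G hGrep hG0 φ φH hH hEL b.tgt, interp_error_eq_kernel c C G hGrep hG0 φ φH hH hEL b.src,
    ← Finset.sum_sub_distrib, Finset.smul_sum]
  refine Finset.sum_congr rfl fun z _ => ?_
  rw [← sub_smul, smul_smul]

/-- ★★★ **`hInterp` FROM THE KERNEL BOUND ALONE**: if `‖Δφ(z)‖ ≤ s₁` everywhere and `Σ_z|K(b,z)| ≤ κ_b`, then `‖∂(φ − φ_H)(b)‖ ≤ κ_b·s₁` — so the displayed row of
✓ `…CentreHarmonicRegaugeSup.sup_regauge_le_of_rows` holds with `c_I·ℓ := sup_b Σ_z|K(b,z)|`; the `W^{1,∞}` interpolation error depends on `Δφ = ∂^*A` only.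
[cite: Balaban1985RegularSpaces, (1.36) p.82; Balaban1983RegularityDecay, (2.27) p.580] -/
theorem norm_grad_interp_error_le (c : ℝ) (C : Set (Site P j)) (G : Site P j → Site P j → ℝ)
    (hGrep : ∀ e : SiteField P j V, (∀ y ∈ C, e y = 0) → ∀ x, e x = ∑ z, G x z • laplace c (laplace c e) z)
    (hG0 : ∀ x, ∀ y ∈ C, G x y = 0)
    (φ φH : SiteField P j V) (hH : ∀ y ∈ C, φH y = φ y) (hEL : ∀ z ∉ C, laplace c (laplace c φH) z = 0)
    {s₁ : ℝ} (hs₁ : ∀ z, ‖laplace c φ z‖ ≤ s₁) (b : PBond P j) {κ : ℝ}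
    (hK : ∑ z, |c * (laplace c (fun w => G b.tgt w) z - laplace c (fun w => G b.src w) z)| ≤ κ) :
    ‖grad c (fun x => φ x - φH x) b‖ ≤ κ * s₁ := by
  have hs0 : 0 ≤ s₁ := (norm_nonneg _).trans (hs₁ b.src)
  rw [grad_interp_error_eq_kernel c C G hGrep hG0 φ φH hH hEL b]
  calc ‖∑ z, (c * (laplace c (fun w => G b.tgt w) z - laplace c (fun w => G b.src w) z)) • laplace c φ z‖
      ≤ ∑ z, ‖(c * (laplace c (fun w => G b.tgt w) z - laplace c (fun w => G b.src w) z)) • laplace c φ z‖ := norm_sum_le _ _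
    _ ≤ ∑ z, |c * (laplace c (fun w => G b.tgt w) z - laplace c (fun w => G b.src w) z)| * s₁ := by
        refine Finset.sum_le_sum fun z _ => ?_
        rw [norm_smul, Real.norm_eq_abs]
        exact mul_le_mul_of_nonneg_left (hs₁ z) (abs_nonneg _)
    _ = (∑ z, |c * (laplace c (fun w => G b.tgt w) z - laplace c (fun w => G b.src w) z)|) * s₁ := by rw [Finset.sum_mul]
    _ ≤ κ * s₁ := mul_le_mul_of_nonneg_right hK hs0

end Summit.QuantumFields.YangMills.Theorems.Prop7CentreHarmonicInterpKernel
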